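import Mathlib
import Summits.BirchSwinnertonDyer.BirchSwinnertonDyer.Theorems.KatoDescentTamePotSupersingularTameLowerFibreAdjointBricksFiveSmu

/-!
# Bricks for the `GL₂(𝔽₅)`-lifting route (T5′), V: no proper subgroup of `S^μ(ℤ/5^{m+1})` covers `S^μ(ℤ/5^m)`

Continuation of `…TameLowerFibreAdjointBricksFive{,Det,Inflation,Smu}` (same namespace). ARM-P audit
r07 S7 ADDENDUM-1 §C proves the lifting statement (T5′) through its Artinian kernel (P′): for a small
surjection `π : A → B` of local Artinian rings (`m_A · ker π = 0`) and a subgroup `H ≤ S^μ(A)` with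
`π(H) = S^μ(W_B)`, some `u ≡ 1 (mod ker π)` has `u H u⁻¹ ⊇ S^μ(W_A)` (`S^μ = {det ∈ μ₄}`, `W` = the
image of `ℤ₅`). This file is the kernel theorem for the UNRAMIFIED direction of (P′) — the layers
`A = W_A = ℤ/5^{m+1} → B = ℤ/5^m` — where the conclusion holds with `u = 1`:

* `smu_mem_of_forall_exists_map_eq` — for `m ≥ 1`, a subgroup `H ≤ GL₂(ℤ/5^{m+1})` all of whose
  elements have `det⁴ = 1` and whose reduction covers `S^μ(ℤ/5^m)` IS `S^μ(ℤ/5^{m+1})`. Proof = the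
  (C3)(f)/(e) mechanism in the kernel: `N̄ = {X ∈ 𝔰𝔩₂(𝔽₅) : 1 + 5^m X̃ ∈ H}` is a subspace of `𝔰𝔩₂(𝔽₅)`
  stable under the transvections (conjugate by lifts IN `H`), hence `0` or `𝔰𝔩₂` ([M] Lemma 3.3,
  `traceless_submodule_eq_bot_or_top`, file I); if `𝔰𝔩₂`, `H` contains the kernel and everything;
  if `0`, `H` meets the kernel trivially and `q ↦ (the h ∈ H over q)` is a homomorphic section
  `SL₂(ℤ/5^m) → GL₂(ℤ/5^{m+1})` with determinants in `μ₄`, excluded by `not_exists_section_detPowFour`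
  (file II = (C3)(e)). The kernel of `S^μ(ℤ/5^{m+1}) → S^μ(ℤ/5^m)` is identified with `𝔰𝔩₂(𝔽₅)` through
  `det_eq_one_of_det_pow_four_of_map_eq_one` (file IV).
  (The tower form — residual image `GL₂(𝔽₅)` ⇒ `H = S^μ(ℤ/5^{m+1})`, i.e. (T5′) for `A = ℤ₅` at
  every finite level — follows by induction in file VI; the gap Δ1 concerns `A = 𝒪_𝔭 ≠ ℤ₅`.)
* `eq_top_of_normal_of_index_eq_pow_five` — (C3)(a)'s finite-group input: a normal subgroup of
  `GL₂(𝔽₅)` of `5`-power index is everything (`d = diag(2,1)` has `d^{5^k} = d`, so `d ∈ N`; then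
  `u⁻¹ = (u d u⁻¹) d⁻¹ ∈ N`, `v³ = (v d v⁻¹) d⁻¹ ∈ N`; Bruhat generation `GL2F5AdjointH1.eq_top_of_mem`).

Route-free, no definitions, nothing about elliptic curves or items 19618/19981 (open). Target
T-S7r07-1 (`FibreLatticeInput 5`).
-/

set_option linter.dupNamespace false

open Matrix

namespace Summit.BirchSwinnertonDyer.BirchSwinnertonDyer.Theorems.GL2F5AdjointBricks

section reduction

/-- **(C3)(a): `GL₂(𝔽₅)` has no proper normal subgroup of `5`-power index.** If `N ◁ GL₂(𝔽₅)` has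
index `5^k` then `N = ⊤`: `d = diag(2, 1)` satisfies `d^{5^k} ∈ N` (`Subgroup.pow_index_mem`) and
`d⁴ = 1`, `5^k ≡ 1 (mod 4)`, so `d ∈ N`; normality gives `u⁻¹ = (u d u⁻¹) d⁻¹ ∈ N` and
`v³ = (v d v⁻¹) d⁻¹ ∈ N` for the transvections `u = (1 1; 0 1)`, `v = (1 0; 1 1)`, hence `u, v ∈ N`,
and `u, v, d` generate (`GL2F5AdjointH1.eq_top_of_mem`). -/
theorem eq_top_of_normal_of_index_eq_pow_five (N : Subgroup (GL (Fin 2) (ZMod 5))) [N.Normal] (k : ℕ)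
    (hk : N.index = 5 ^ k) : N = ⊤ := by
  set u : GL (Fin 2) (ZMod 5) := ⟨!![1, 1; 0, 1], !![1, 4; 0, 1], by decide, by decide⟩ with u_def
  set v : GL (Fin 2) (ZMod 5) := ⟨!![1, 0; 1, 1], !![1, 0; 4, 1], by decide, by decide⟩ with v_def
  set d : GL (Fin 2) (ZMod 5) := ⟨!![2, 0; 0, 1], !![3, 0; 0, 1], by decide, by decide⟩ with d_def
  -- `d ∈ N`
  have hd4 : d ^ 4 = 1 := by decide
  have hmod : 5 ^ k % 4 = 1 := by
    rw [Nat.pow_mod]; norm_num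
  have hdN : d ∈ N := by
    have h := N.pow_index_mem d
    rw [hk, ← Nat.div_add_mod (5 ^ k) 4, hmod, pow_add, pow_mul, hd4, one_pow, one_mul, pow_one] at h
    exact h
  -- `u ∈ N`, `v ∈ N` by normality
  have huN : u ∈ N := by
    have h1 : u * d * u⁻¹ ∈ N := Subgroup.Normal.conj_mem inferInstance d hdN u
    have h2 : u * d * u⁻¹ * d⁻¹ = u⁻¹ := by decide
    have h3 : u⁻¹ ∈ N := h2 ▸ N.mul_mem h1 (N.inv_mem hdN)
    simpa using N.inv_mem h3
  have hvN : v ∈ N := by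
    have h1 : v * d * v⁻¹ ∈ N := Subgroup.Normal.conj_mem inferInstance d hdN v
    have h2 : v * d * v⁻¹ * d⁻¹ = v ^ 3 := by decide
    have h3 : v ^ 3 ∈ N := h2 ▸ N.mul_mem h1 (N.inv_mem hdN)
    have h4 : (v ^ 3) ^ 2 = v := by decide
    exact h4 ▸ N.pow_mem h3 2
  refine GL2F5AdjointH1.eq_top_of_mem N ?_ ?_ ?_
  · intro g hg; have : g = u := Units.ext hg; exact this ▸ huN
  · intro g hg; have : g = v := Units.ext hg; exact this ▸ hvN
  · intro g hg; have : g = d := Units.ext hg; exact this ▸ hdN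

end reduction

section frattini

/-- **No proper subgroup of `S^μ(ℤ/5^{m+1})` covers `S^μ(ℤ/5^m)` (`m ≥ 1`)** — the unramified layer
of (P′), with conjugator `u = 1`. Let `H ≤ GL₂(ℤ/5^{m+1})` be a subgroup with `(det h)⁴ = 1` for all
`h ∈ H` whose reduction modulo `5^m` hits every `q ∈ GL₂(ℤ/5^m)` with `(det q)⁴ = 1`. Then every
`g ∈ GL₂(ℤ/5^{m+1})` with `(det g)⁴ = 1` lies in `H`. -/
theorem smu_mem_of_forall_exists_map_eq (m : ℕ) (hm : 1 ≤ m)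
    (H : Subgroup (GL (Fin 2) (ZMod (5 ^ (m + 1)))))
    (hHμ : ∀ h ∈ H, Matrix.det (h : Matrix (Fin 2) (Fin 2) (ZMod (5 ^ (m + 1)))) ^ 4 = 1)
    (hsurj : ∀ q : GL (Fin 2) (ZMod (5 ^ m)),
      Matrix.det (q : Matrix (Fin 2) (Fin 2) (ZMod (5 ^ m))) ^ 4 = 1 →
        ∃ h ∈ H, Matrix.GeneralLinearGroup.map (ZMod.castHom (pow_dvd_pow 5 m.le_succ) (ZMod (5 ^ m))) h = q)
    (g : GL (Fin 2) (ZMod (5 ^ (m + 1))))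
    (hg : Matrix.det (g : Matrix (Fin 2) (Fin 2) (ZMod (5 ^ (m + 1)))) ^ 4 = 1) : g ∈ H := by
  classical
  have h25 : (2 : ZMod 5) ≠ 0 := by decide
  haveI : NeZero (5 ^ (m + 1)) := ⟨pow_ne_zero _ (by norm_num)⟩
  haveI : NeZero (5 ^ m) := ⟨pow_ne_zero _ (by norm_num)⟩
  haveI : Fact (Nat.Prime 5) := ⟨by norm_num⟩
  -- notation
  set c5 := ZMod.castHom (dvd_pow_self 5 (Nat.succ_ne_zero m)) (ZMod 5) with hc5
  set cm := ZMod.castHom (pow_dvd_pow 5 m.le_succ) (ZMod (5 ^ m)) with hcm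
  have hm0 : m ≠ 0 := by omega
  set c5' := ZMod.castHom (dvd_pow_self 5 hm0) (ZMod 5) with hc5'
  have hcomp : c5'.comp cm = c5 := Subsingleton.elim _ _
  set ρ := Matrix.GeneralLinearGroup.map (n := Fin 2) c5 with hρ
  set red := Matrix.GeneralLinearGroup.map (n := Fin 2) cm with hred
  set π : ZMod (5 ^ (m + 1)) := (5 : ZMod (5 ^ (m + 1))) ^ m with hπ_def
  -- arithmetic of `π`
  have h0 : (5 : ZMod (5 ^ (m + 1))) ^ (m + 1) = 0 := by exact_mod_cast ZMod.natCast_self (5 ^ (m + 1))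
  have hπ2 : π * π = 0 := by rw [hπ_def, ← pow_add]; exact pow_eq_zero_of_le (by omega) h0
  have h5π : 5 * π = 0 := by rw [hπ_def, ← pow_succ', h0]
  have hπ5 : π * 5 = 0 := by rw [mul_comm, h5π]
  have hπcast : ((5 ^ m : ℕ) : ZMod (5 ^ (m + 1))) = π := by rw [hπ_def]; push_cast; rfl
  have hc5π : c5 π = 0 := by rw [hπ_def, map_pow, map_ofNat, show (5 : ZMod 5) = 0 from rfl, zero_pow (by omega)]
  have hcmπ : cm π = 0 := by
    rw [hπ_def, map_pow, map_ofNat]; exact_mod_cast ZMod.natCast_self (5 ^ m)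
  have L : ∀ y y' : ZMod (5 ^ (m + 1)), c5 y = c5 y' → π * y = π * y' := by
    intro y y' h
    have hz : c5 (y - y') = 0 := by rw [map_sub, h, sub_self]
    obtain ⟨t, ht⟩ := exists_eq_mul_of_cast_eq_zero _ _ hz
    rw [← sub_eq_zero, ← mul_sub, ht, ← mul_assoc, Nat.cast_ofNat, hπ5, zero_mul]
  have L' : ∀ y : ZMod (5 ^ (m + 1)), π * y = 0 → c5 y = 0 := by
    intro y hy
    have hdiv : 5 ^ (m + 1) ∣ 5 ^ m * y.val := by
      rw [← ZMod.natCast_eq_zero_iff, Nat.cast_mul, hπcast, ZMod.natCast_zmod_val]; exact hy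
    have h' : 5 ^ m * 5 ∣ 5 ^ m * y.val := (dvd_of_eq (pow_succ 5 m).symm).trans hdiv
    rw [← ZMod.natCast_zmod_val y, map_natCast, ZMod.natCast_eq_zero_iff]
    exact Nat.dvd_of_mul_dvd_mul_left (pow_pos (by norm_num) m) h'
  have LM : ∀ Y Y' : Matrix (Fin 2) (Fin 2) (ZMod (5 ^ (m + 1))),
      (∀ i j, c5 (Y i j) = c5 (Y' i j)) → π • Y = π • Y' := by
    intro Y Y' h; ext i j; simp only [Matrix.smul_apply, smul_eq_mul]; exact L _ _ (h i j)
  -- determinants along `red`, products, inverses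
  have hμ_red : ∀ x : GL (Fin 2) (ZMod (5 ^ (m + 1))),
      Matrix.det (x : Matrix (Fin 2) (Fin 2) (ZMod (5 ^ (m + 1)))) ^ 4 = 1 →
      Matrix.det ((red x : GL (Fin 2) (ZMod (5 ^ m))) : Matrix (Fin 2) (Fin 2) (ZMod (5 ^ m))) ^ 4 = 1 := by
    intro x hx
    have hd : Matrix.det ((red x : GL (Fin 2) (ZMod (5 ^ m))) : Matrix (Fin 2) (Fin 2) (ZMod (5 ^ m))) =
        cm (Matrix.det (x : Matrix (Fin 2) (Fin 2) (ZMod (5 ^ (m + 1))))) := by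
      rw [RingHom.map_det]; congr 1
    rw [hd, ← map_pow, hx, map_one]
  have hμ_mul : ∀ x y : GL (Fin 2) (ZMod (5 ^ (m + 1))),
      Matrix.det (x : Matrix (Fin 2) (Fin 2) (ZMod (5 ^ (m + 1)))) ^ 4 = 1 →
      Matrix.det (y : Matrix (Fin 2) (Fin 2) (ZMod (5 ^ (m + 1)))) ^ 4 = 1 →
      Matrix.det ((x * y : GL (Fin 2) (ZMod (5 ^ (m + 1)))) : Matrix (Fin 2) (Fin 2) (ZMod (5 ^ (m + 1)))) ^ 4 = 1 := by
    intro x y hx hy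
    rw [Units.val_mul, Matrix.det_mul, mul_pow, hx, hy, one_mul]
  have hμ_inv : ∀ x : GL (Fin 2) (ZMod (5 ^ (m + 1))),
      Matrix.det (x : Matrix (Fin 2) (Fin 2) (ZMod (5 ^ (m + 1)))) ^ 4 = 1 →
      Matrix.det ((x⁻¹ : GL (Fin 2) (ZMod (5 ^ (m + 1)))) : Matrix (Fin 2) (Fin 2) (ZMod (5 ^ (m + 1)))) ^ 4 = 1 := by
    intro x hx
    have h1 : Matrix.det (x : Matrix (Fin 2) (Fin 2) (ZMod (5 ^ (m + 1)))) *
        Matrix.det ((x⁻¹ : GL (Fin 2) (ZMod (5 ^ (m + 1)))) : Matrix (Fin 2) (Fin 2) (ZMod (5 ^ (m + 1)))) = 1 := by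
      rw [← Matrix.det_mul, ← Units.val_mul, mul_inv_cancel, Units.val_one, Matrix.det_one]
    have h2 := congrArg (· ^ 4) h1
    simp only [mul_pow, hx, one_mul, one_pow] at h2
    exact h2
  -- `red x = 1 ⇒ ρ x = 1 ⇒ det x = 1`
  have hρ_of_red : ∀ x : GL (Fin 2) (ZMod (5 ^ (m + 1))), red x = 1 → ρ x = 1 := by
    intro x hx
    have h : Matrix.GeneralLinearGroup.map (n := Fin 2) (c5'.comp cm) x = ρ x := by rw [hcomp]
    rw [← h, Matrix.GeneralLinearGroup.map_comp]
    show Matrix.GeneralLinearGroup.map c5' (red x) = 1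
    rw [hx, map_one]
  -- (1) the traceless lift `Λ X` and `κ X = 1 + π Λ X`
  let Λ : Matrix (Fin 2) (Fin 2) (ZMod 5) → Matrix (Fin 2) (Fin 2) (ZMod (5 ^ (m + 1))) := fun X =>
    !![((X 0 0).val : ZMod (5 ^ (m + 1))), ((X 0 1).val : ZMod (5 ^ (m + 1)));
       ((X 1 0).val : ZMod (5 ^ (m + 1))), -((X 0 0).val : ZMod (5 ^ (m + 1)))]
  have hΛc : ∀ X : Matrix (Fin 2) (Fin 2) (ZMod 5), Matrix.trace X = 0 →
      ∀ i j, c5 (Λ X i j) = X i j := by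
    intro X hX i j
    have hX11 : X 1 1 = -X 0 0 := by
      rw [Matrix.trace_fin_two] at hX; linear_combination hX
    fin_cases i <;> fin_cases j <;> simp [Λ, map_neg, hX11]
  have hΛΛ : ∀ X, (π • Λ X) * (π • Λ X) = 0 := fun X => by
    rw [smul_mul_assoc, mul_smul_comm, smul_smul, hπ2, zero_smul]
  have hκmul : ∀ X, (1 + π • Λ X) * (1 - π • Λ X) = 1 := fun X => by
    simp only [mul_sub, add_mul, one_mul, mul_one, hΛΛ]; abel
  have hκmul' : ∀ X, (1 - π • Λ X) * (1 + π • Λ X) = 1 := fun X => by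
    simp only [mul_add, sub_mul, one_mul, mul_one, hΛΛ, sub_zero]; abel
  let κ : Matrix (Fin 2) (Fin 2) (ZMod 5) → GL (Fin 2) (ZMod (5 ^ (m + 1))) :=
    fun X => ⟨1 + π • Λ X, 1 - π • Λ X, hκmul X, hκmul' X⟩
  have hκval : ∀ X, (κ X).val = 1 + π • Λ X := fun X => rfl
  have hredκ : ∀ X, red (κ X) = 1 := by
    intro X
    apply Units.ext
    ext i j
    rw [Matrix.GeneralLinearGroup.map_apply, Units.val_one]
    show cm ((1 + π • Λ X) i j) = _
    rw [Matrix.add_apply, Matrix.smul_apply, smul_eq_mul, map_add, map_mul, hcmπ, zero_mul, add_zero,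
      Matrix.one_apply, Matrix.one_apply, apply_ite cm, map_one, map_zero]
  have hκadd : ∀ X X', κ (X + X') = κ X * κ X' := by
    intro X X'
    apply Units.ext
    rw [Units.val_mul, hκval, hκval, hκval]
    have hsq : (π • Λ X) * (π • Λ X') = 0 := by
      rw [smul_mul_assoc, mul_smul_comm, smul_smul, hπ2, zero_smul]
    have hprod : (1 + π • Λ X) * (1 + π • Λ X') = 1 + (π • Λ X + π • Λ X') := by
      simp only [add_mul, mul_add, one_mul, mul_one, hsq, add_zero]
      abel
    rw [hprod, ← smul_add]
    congr 1
    apply LM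
    intro i j
    rw [Matrix.add_apply, map_add]
    fin_cases i <;> fin_cases j <;> simp [Λ, map_neg]
    all_goals ring
  have hκzero : κ 0 = 1 := by
    apply Units.ext
    have : Λ 0 = 0 := by ext i j; fin_cases i <;> fin_cases j <;> simp [Λ]
    rw [hκval, Units.val_one, this, smul_zero, add_zero]
  -- every `x` with `det⁴ = 1` and `red x = 1` is a `κ X` with `X` trace-zero
  have hK : ∀ x : GL (Fin 2) (ZMod (5 ^ (m + 1))),
      Matrix.det (x : Matrix (Fin 2) (Fin 2) (ZMod (5 ^ (m + 1)))) ^ 4 = 1 → red x = 1 →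
      ∃ X : Matrix (Fin 2) (Fin 2) (ZMod 5), Matrix.trace X = 0 ∧ x = κ X := by
    intro x hxμ hx
    have hdetx : Matrix.det (x : Matrix (Fin 2) (Fin 2) (ZMod (5 ^ (m + 1)))) = 1 :=
      det_eq_one_of_det_pow_four_of_map_eq_one m x hxμ (hρ_of_red x hx)
    have hent : ∀ i j, ∃ t : ZMod (5 ^ (m + 1)),
        (x : Matrix (Fin 2) (Fin 2) (ZMod (5 ^ (m + 1)))) i j =
          (1 : Matrix (Fin 2) (Fin 2) (ZMod (5 ^ (m + 1)))) i j + π * t := by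
      intro i j
      have h := congrArg (fun g : GL (Fin 2) (ZMod (5 ^ m)) =>
        (g : Matrix (Fin 2) (Fin 2) (ZMod (5 ^ m))) i j) hx
      simp only [hred, Matrix.GeneralLinearGroup.map_apply, Units.val_one] at h
      have hz : cm ((x : Matrix (Fin 2) (Fin 2) (ZMod (5 ^ (m + 1)))) i j -
          (1 : Matrix (Fin 2) (Fin 2) (ZMod (5 ^ (m + 1)))) i j) = 0 := by
        rw [map_sub, h, sub_eq_zero, Matrix.one_apply, Matrix.one_apply, apply_ite cm, map_one, map_zero]
      obtain ⟨t, ht⟩ := exists_eq_mul_of_castHom_eq_zero m _ hz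
      exact ⟨t, by rw [← sub_eq_iff_eq_add', ht, hπcast]⟩
    choose Y hY using hent
    have hxval : (x : Matrix (Fin 2) (Fin 2) (ZMod (5 ^ (m + 1)))) = 1 + π • Matrix.of Y := by
      ext i j; rw [hY, Matrix.add_apply, Matrix.smul_apply, smul_eq_mul, Matrix.of_apply]
    rw [hxval, Matrix.det_fin_two] at hdetx
    simp only [Matrix.add_apply, Matrix.one_apply_eq, Matrix.one_apply_ne, Matrix.smul_apply, smul_eq_mul,
      ne_eq, Fin.isValue, zero_ne_one, not_false_eq_true, one_ne_zero, Matrix.of_apply, zero_add] at hdetx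
    have htrY : π * (Y 0 0 + Y 1 1) = 0 := by
      linear_combination hdetx + (Y 0 1 * Y 1 0 - Y 0 0 * Y 1 1) * hπ2
    have htrX : Matrix.trace (c5.mapMatrix (Matrix.of Y)) = 0 := by
      rw [Matrix.trace_fin_two, RingHom.mapMatrix_apply, Matrix.map_apply, Matrix.map_apply, Matrix.of_apply,
        Matrix.of_apply, ← map_add]
      exact L' _ htrY
    refine ⟨c5.mapMatrix (Matrix.of Y), htrX, ?_⟩
    apply Units.ext
    rw [hxval, hκval]
    congr 1
    apply LM
    intro i j
    rw [hΛc _ htrX, RingHom.mapMatrix_apply, Matrix.map_apply]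
  -- conjugating `κ X`
  have hκconj : ∀ (A A' : Matrix (Fin 2) (Fin 2) (ZMod (5 ^ (m + 1)))) (a a' : Matrix (Fin 2) (Fin 2) (ZMod 5)),
      A * A' = 1 → c5.mapMatrix A = a → c5.mapMatrix A' = a' →
      ∀ X : Matrix (Fin 2) (Fin 2) (ZMod 5), Matrix.trace X = 0 →
        A * (1 + π • Λ X) * A' = 1 + π • Λ (a * X * a') := by
    intro A A' a a' hAA' hA hA' X hX
    have htr' : Matrix.trace (a * X * a') = 0 := by
      have haa' : a * a' = 1 := by rw [← hA, ← hA', ← map_mul, hAA', map_one]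
      have ha'a : a' * a = 1 := mul_eq_one_comm.1 haa'
      rw [Matrix.mul_assoc, Matrix.trace_mul_comm, Matrix.mul_assoc, ha'a, Matrix.mul_one]; exact hX
    rw [mul_add, add_mul, mul_one, hAA', Matrix.mul_smul, Matrix.smul_mul]
    congr 1
    apply LM
    intro i j
    rw [hΛc _ htr' i j]
    have hc5Λ : c5.mapMatrix (Λ X) = X := by
      ext i j; rw [RingHom.mapMatrix_apply, Matrix.map_apply]; exact hΛc X hX i j
    have h := congrArg (fun M : Matrix (Fin 2) (Fin 2) (ZMod 5) => M i j)
      (show c5.mapMatrix (A * Λ X * A') = a * X * a' by rw [map_mul, map_mul, hA, hA', hc5Λ])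
    simpa [RingHom.mapMatrix_apply] using h
  -- (2) lifts IN `H` of the two transvections of level `m`
  have hT : ∀ (t t' : Matrix (Fin 2) (Fin 2) (ZMod (5 ^ m))) (a a' : Matrix (Fin 2) (Fin 2) (ZMod 5)),
      t * t' = 1 → t' * t = 1 → Matrix.det t = 1 → c5'.mapMatrix t = a → c5'.mapMatrix t' = a' →
      ∃ h ∈ H, c5.mapMatrix (h : Matrix (Fin 2) (Fin 2) (ZMod (5 ^ (m + 1)))) = a ∧
        c5.mapMatrix ((h⁻¹ : GL (Fin 2) (ZMod (5 ^ (m + 1)))) : Matrix (Fin 2) (Fin 2) (ZMod (5 ^ (m + 1)))) = a' ∧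
        (h : Matrix (Fin 2) (Fin 2) (ZMod (5 ^ (m + 1)))) *
          ((h⁻¹ : GL (Fin 2) (ZMod (5 ^ (m + 1)))) : Matrix (Fin 2) (Fin 2) (ZMod (5 ^ (m + 1)))) = 1 := by
    intro t t' a a' htt' ht't hdet hta ht'a'
    let q : GL (Fin 2) (ZMod (5 ^ m)) := ⟨t, t', htt', ht't⟩
    have hqμ : Matrix.det (q : Matrix (Fin 2) (Fin 2) (ZMod (5 ^ m))) ^ 4 = 1 := by
      show Matrix.det t ^ 4 = 1; rw [hdet, one_pow]
    obtain ⟨h, hhH, hhq⟩ := hsurj q hqμ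
    have hval : cm.mapMatrix (h : Matrix (Fin 2) (Fin 2) (ZMod (5 ^ (m + 1)))) = t :=
      congrArg (fun g : GL (Fin 2) (ZMod (5 ^ m)) => (g : Matrix (Fin 2) (Fin 2) (ZMod (5 ^ m)))) hhq
    have hval' : cm.mapMatrix ((h⁻¹ : GL (Fin 2) (ZMod (5 ^ (m + 1)))) : Matrix (Fin 2) (Fin 2) (ZMod (5 ^ (m + 1)))) = t' := by
      have hhq' : red h⁻¹ = q⁻¹ := by rw [map_inv, hhq]
      exact congrArg (fun g : GL (Fin 2) (ZMod (5 ^ m)) => (g : Matrix (Fin 2) (Fin 2) (ZMod (5 ^ m)))) hhq'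
    refine ⟨h, hhH, ?_, ?_, ?_⟩
    · rw [← hcomp, ← hta, ← hval]; rfl
    · rw [← hcomp, ← ht'a', ← hval']; rfl
    · rw [← Units.val_mul, mul_inv_cancel, Units.val_one]
  have hc5'u : c5'.mapMatrix (!![1, 1; 0, 1] : Matrix (Fin 2) (Fin 2) (ZMod (5 ^ m))) = !![1, 1; 0, 1] := by
    ext i j; fin_cases i <;> fin_cases j <;> simp [RingHom.mapMatrix_apply]
  have hc5'u' : c5'.mapMatrix (!![1, -1; 0, 1] : Matrix (Fin 2) (Fin 2) (ZMod (5 ^ m))) = !![1, -1; 0, 1] := by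
    ext i j; fin_cases i <;> fin_cases j <;> simp [RingHom.mapMatrix_apply]
  have hc5'v : c5'.mapMatrix (!![1, 0; 1, 1] : Matrix (Fin 2) (Fin 2) (ZMod (5 ^ m))) = !![1, 0; 1, 1] := by
    ext i j; fin_cases i <;> fin_cases j <;> simp [RingHom.mapMatrix_apply]
  have hc5'v' : c5'.mapMatrix (!![1, 0; -1, 1] : Matrix (Fin 2) (Fin 2) (ZMod (5 ^ m))) = !![1, 0; -1, 1] := by
    ext i j; fin_cases i <;> fin_cases j <;> simp [RingHom.mapMatrix_apply]
  have huu' : (!![1, 1; 0, 1] : Matrix (Fin 2) (Fin 2) (ZMod (5 ^ m))) * !![1, -1; 0, 1] = 1 := by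
    rw [Matrix.mul_fin_two, Matrix.one_fin_two]; ext i j; fin_cases i <;> fin_cases j <;> simp
  have hu'u : (!![1, -1; 0, 1] : Matrix (Fin 2) (Fin 2) (ZMod (5 ^ m))) * !![1, 1; 0, 1] = 1 := by
    rw [Matrix.mul_fin_two, Matrix.one_fin_two]; ext i j; fin_cases i <;> fin_cases j <;> simp
  have hvv' : (!![1, 0; 1, 1] : Matrix (Fin 2) (Fin 2) (ZMod (5 ^ m))) * !![1, 0; -1, 1] = 1 := by
    rw [Matrix.mul_fin_two, Matrix.one_fin_two]; ext i j; fin_cases i <;> fin_cases j <;> simp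
  have hv'v : (!![1, 0; -1, 1] : Matrix (Fin 2) (Fin 2) (ZMod (5 ^ m))) * !![1, 0; 1, 1] = 1 := by
    rw [Matrix.mul_fin_two, Matrix.one_fin_two]; ext i j; fin_cases i <;> fin_cases j <;> simp
  have hdetu : Matrix.det (!![1, 1; 0, 1] : Matrix (Fin 2) (Fin 2) (ZMod (5 ^ m))) = 1 := by simp [Matrix.det_fin_two]
  have hdetv : Matrix.det (!![1, 0; 1, 1] : Matrix (Fin 2) (Fin 2) (ZMod (5 ^ m))) = 1 := by simp [Matrix.det_fin_two]
  obtain ⟨hu, huH, hua, hua', huu⟩ := hT _ _ _ _ huu' hu'u hdetu hc5'u hc5'u'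
  obtain ⟨hv, hvH, hva, hva', hvv⟩ := hT _ _ _ _ hvv' hv'v hdetv hc5'v hc5'v'
  have hκu : ∀ X : Matrix (Fin 2) (Fin 2) (ZMod 5), Matrix.trace X = 0 →
      hu * κ X * hu⁻¹ = κ (!![1, 1; 0, 1] * X * !![1, -1; 0, 1]) := fun X hX => by
    apply Units.ext; rw [Units.val_mul, Units.val_mul, hκval, hκval]; exact hκconj _ _ _ _ huu hua hua' X hX
  have hκv : ∀ X : Matrix (Fin 2) (Fin 2) (ZMod 5), Matrix.trace X = 0 →
      hv * κ X * hv⁻¹ = κ (!![1, 0; 1, 1] * X * !![1, 0; -1, 1]) := fun X hX => by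
    apply Units.ext; rw [Units.val_mul, Units.val_mul, hκval, hκval]; exact hκconj _ _ _ _ hvv hva hva' X hX
  -- (3) the subspace `N̄ = {X ∈ 𝔰𝔩₂(𝔽₅) : κ X ∈ H}`
  let Nbar : Submodule (ZMod 5) (Matrix (Fin 2) (Fin 2) (ZMod 5)) :=
    { carrier := {X | Matrix.trace X = 0 ∧ κ X ∈ H}
      add_mem' := by
        rintro X X' ⟨hX, hXH⟩ ⟨hX', hX'H⟩
        refine ⟨by rw [Matrix.trace_add, hX, hX', add_zero], ?_⟩
        show κ (X + X') ∈ H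
        rw [hκadd]; exact H.mul_mem hXH hX'H
      zero_mem' := ⟨Matrix.trace_zero _ _, by show κ 0 ∈ H; rw [hκzero]; exact H.one_mem⟩
      smul_mem' := by
        rintro c X ⟨hX, hXH⟩
        refine ⟨by rw [Matrix.trace_smul, hX, smul_zero], ?_⟩
        show κ (c • X) ∈ H
        have hc : c • X = c.val • X := by
          rw [← ZMod.natCast_zmod_val c, Nat.cast_smul_eq_nsmul]; simp
        rw [hc]
        induction c.val with
        | zero => rw [zero_smul, hκzero]; exact H.one_mem
        | succ n ih => rw [succ_nsmul, hκadd]; exact H.mul_mem ih hXH }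
  have hNtr : ∀ X ∈ Nbar, Matrix.trace X = 0 := fun X hX => hX.1
  have hNu : ∀ X ∈ Nbar, !![1, 1; 0, 1] * X * !![1, -1; 0, 1] ∈ Nbar := by
    rintro X ⟨hX, hXH⟩
    refine ⟨?_, ?_⟩
    · rw [Matrix.mul_assoc, Matrix.trace_mul_comm, Matrix.mul_assoc]
      have : (!![1, -1; 0, 1] : Matrix (Fin 2) (Fin 2) (ZMod 5)) * !![1, 1; 0, 1] = 1 := by
        rw [Matrix.mul_fin_two, Matrix.one_fin_two]; ext i j; fin_cases i <;> fin_cases j <;> simp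
      rw [this, Matrix.mul_one]; exact hX
    · show κ _ ∈ H
      rw [← hκu X hX]; exact H.mul_mem (H.mul_mem huH hXH) (H.inv_mem huH)
  have hNv : ∀ X ∈ Nbar, !![1, 0; 1, 1] * X * !![1, 0; -1, 1] ∈ Nbar := by
    rintro X ⟨hX, hXH⟩
    refine ⟨?_, ?_⟩
    · rw [Matrix.mul_assoc, Matrix.trace_mul_comm, Matrix.mul_assoc]
      have : (!![1, 0; -1, 1] : Matrix (Fin 2) (Fin 2) (ZMod 5)) * !![1, 0; 1, 1] = 1 := by
        rw [Matrix.mul_fin_two, Matrix.one_fin_two]; ext i j; fin_cases i <;> fin_cases j <;> simp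
      rw [this, Matrix.mul_one]; exact hX
    · show κ _ ∈ H
      rw [← hκv X hX]; exact H.mul_mem (H.mul_mem hvH hXH) (H.inv_mem hvH)
  -- (4) dichotomy
  rcases traceless_submodule_eq_bot_or_top (F := ZMod 5) h25 Nbar hNtr hNu hNv with hbot | htop
  · -- `N̄ = 0`: `H` is a homomorphic section over `SL₂(ℤ/5^m)` — impossible
    exfalso
    have hHK : ∀ x ∈ H, red x = 1 → x = 1 := by
      intro x hxH hx
      obtain ⟨X, hX, rfl⟩ := hK x (hHμ x hxH) hx
      have hXN : X ∈ Nbar := ⟨hX, hxH⟩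
      rw [hbot] at hXN
      rw [(Submodule.mem_bot (R := ZMod 5)).1 hXN, hκzero]
    have hU : ∀ x y : GL (Fin 2) (ZMod (5 ^ (m + 1))), x ∈ H → y ∈ H → red x = red y → x = y := by
      intro x y hx hy hxy
      have h1 : x⁻¹ * y = 1 :=
        hHK _ (H.mul_mem (H.inv_mem hx) hy) (by rw [map_mul, map_inv, hxy, inv_mul_cancel])
      rw [← mul_one x, ← h1, mul_inv_cancel_left]
    have hSμ : ∀ a : Matrix.SpecialLinearGroup (Fin 2) (ZMod (5 ^ m)),
        Matrix.det ((Matrix.SpecialLinearGroup.toGL a : GL (Fin 2) (ZMod (5 ^ m))) :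
          Matrix (Fin 2) (Fin 2) (ZMod (5 ^ m))) ^ 4 = 1 := by
      intro a; rw [Matrix.SpecialLinearGroup.coe_GL_coe_matrix, a.prop, one_pow]
    have hsec : ∀ a : Matrix.SpecialLinearGroup (Fin 2) (ZMod (5 ^ m)),
        ∃ h : GL (Fin 2) (ZMod (5 ^ (m + 1))), h ∈ H ∧ red h = Matrix.SpecialLinearGroup.toGL a := fun a => by
      obtain ⟨h, hh, hha⟩ := hsurj _ (hSμ a); exact ⟨h, hh, hha⟩
    choose s hsH hsred using hsec
    let σ : Matrix.SpecialLinearGroup (Fin 2) (ZMod (5 ^ m)) →* GL (Fin 2) (ZMod (5 ^ (m + 1))) :=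
      { toFun := s
        map_one' := hU _ _ (hsH 1) H.one_mem (by rw [hsred, map_one, map_one])
        map_mul' := fun a b => hU _ _ (hsH _) (H.mul_mem (hsH a) (hsH b))
          (by rw [hsred, map_mul, map_mul, hsred, hsred]) }
    refine not_exists_section_detPowFour m hm ⟨σ, fun a => hHμ _ (hsH a), fun a => ?_⟩
    show cm.mapMatrix ((s a : GL (Fin 2) (ZMod (5 ^ (m + 1)))) : Matrix (Fin 2) (Fin 2) (ZMod (5 ^ (m + 1)))) =
      ((Matrix.SpecialLinearGroup.toGL a : GL (Fin 2) (ZMod (5 ^ m))) : Matrix (Fin 2) (Fin 2) (ZMod (5 ^ m)))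
    exact congrArg (fun g : GL (Fin 2) (ZMod (5 ^ m)) => (g : Matrix (Fin 2) (Fin 2) (ZMod (5 ^ m)))) (hsred a)
  · -- `N̄ = 𝔰𝔩₂`: `H` contains the kernel, hence `g`
    obtain ⟨h, hhH, hhg⟩ := hsurj (red g) (hμ_red g hg)
    have hkμ := hμ_mul _ _ (hμ_inv _ (hHμ h hhH)) hg
    have hk : red (h⁻¹ * g) = 1 := by rw [map_mul, map_inv, hhg, inv_mul_cancel]
    obtain ⟨X, hX, hkX⟩ := hK _ hkμ hk
    have hkH : h⁻¹ * g ∈ H := by rw [hkX]; exact (htop X hX).2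
    have := H.mul_mem hhH hkH
    rwa [mul_inv_cancel_left] at this

end frattini

end Summit.BirchSwinnertonDyer.BirchSwinnertonDyer.Theorems.GL2F5AdjointBricks
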